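import Summits.HodgeConjecture.HodgeConjecture.Theorems.MarkmanPartnerTransportIsometrySpannedThirdClassEndomorphism
import Mathlib.LinearAlgebra.BilinearForm.Orthogonal
import HarnessLib

/-!
# Route MarkmanPartnerTransport · the kappa class of a Hodge endomorphism is a RATIONAL HODGE `(2,2)`-CLASS

Sub-problem `HodgeConjecture`, route MarkmanPartnerTransport (cell hodge-nonav; toolkit for the «ORPHAN LEVERS»
chapter, memo ROUTE-P1AJ). For a marked smooth projective fourfold `(X, φ, P, z)` (clauses (m1)–(m6)) and a
`ℂ`-linear endomorphism `g` of `H²(X(ℂ); ℂ)`, the kappa class `κ_g = Σᵢⱼ (G⁻¹)ᵢⱼ · φ⁻¹eᵢ ∪ g(φ⁻¹eⱼ)` satisfies: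

* `isRationalClass_kappaClass` — `κ_g` is RATIONAL when `g` preserves rational classes (`G⁻¹ ∈ M₂₃(ℚ)`, the `αᵢ` are
  integral);
* `kappaClass_eq_sum_of_resolution` — for ANY finite family `(vₖ, v'ₖ)` resolving `q⁻¹`,
  `Σₖ φ(v'ₖ)ᵢ φ(vₖ)ⱼ = (G⁻¹)ᵢⱼ`, one has `κ_g = Σₖ v'ₖ ∪ g(vₖ)` (bilinearity: `κ_g` is the contraction of `g`
  against the inverse tensor `q⁻¹ ∈ H² ⊗ H²`, independent of the resolution);
* `resolution_of_complete` — a `q`-complete family (`Σₖ q(u, vₖ) v'ₖ = u` for all `u`) resolves `q⁻¹`;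
* `exists_hodgeAdapted_complete` — a HODGE-ADAPTED complete family exists: `(σ, σ̄/N)`, `(σ̄, σ/N)` with
  `N = q(z, z̄) ≠ 0`, and a basis of `H^{1,1} = {y : q(φy, z) = q(φy, z̄) = 0}` with its `q`-dual basis
  (`q` restricted to `H^{1,1}` is non-degenerate; `LinearMap.BilinForm.dualBasis`);
* `isOfHodgeType_kappaClass` — **`κ_g` is of Hodge type `(2,2)` when `g` is type-preserving**: in the adapted family
  every term `v'ₖ ∪ g(vₖ)` is `(0,2)·(2,0)`, `(2,0)·(0,2)` or `(1,1)·(1,1)` (`CupPreservesHodgeType`).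

Consumer: `OrphanSR.hodgeConjectureFor_iff_kappaClass_mem_algebraicClasses` — for `E(X) = ℚ(θ)` real quadratic,
HC⁴(X) ⟺ `κ_θ ∈ A²(X)`. No named fact, no definition, no sorry. Prover seat hodge-nonav-20241-p1 (gen 13),
`--supports stmt-HodgeConjecture-19653`.

References: K. O'Grady, Commun. Contemp. Math. 10 (2008) §2–3; C. Voisin, *Hodge Theory I* §6.1, §7.1;
A. Beauville, J. Differential Geom. 18 (1983) §8–9.
-/

noncomputable section

set_option linter.dupNamespace false

open scoped Matrix
open Module CategoryTheory
open Literature.AlgebraicTopology.SingularHomology Literature.Geometry.Kaehler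
open Literature.AlgebraicGeometry Literature.AlgebraicGeometry.Motives Literature.AlgebraicGeometry.HodgeTheory
open Literature.AlgebraicGeometry.Hyperkaehler Literature.AlgebraicGeometry.Surfaces
open Summit.HodgeConjecture.HodgeConjecture.Theorems.NikulinTwinTransport
open Summit.HodgeConjecture.HodgeConjecture.Theorems.MarkmanPartnerTransport.BBFPositivity

namespace Summit.HodgeConjecture.HodgeConjecture.Theorems.MarkmanPartnerTransport.PartnerLattice

/-- `MarkedK3Sq[X, φ, P, z]`: VERBATIM the `let MarkedK3Sq := …` binder of the route declarations of
MarkmanPartnerTransport (clauses (m1)–(m6)). Local notation only. -/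
local notation3 (prettyPrint := false) "MarkedK3Sq[" X ", " φ ", " P ", " z "]" =>
  (((IsIntegralClass P ∧ ∀ Q : complexBetti X (2 * 4), IsIntegralClass Q → ∃ n : ℤ, Q = n • P) ∧
    (∀ c : complexBetti X 2, IsIntegralClass c ↔ ∃ v : K3HilbertIndex → ℤ, φ c = fun i => (v i : ℂ)) ∧
    (∀ a : complexBetti X 2, cupPowTwo a 4 = ((3 : ℂ) * (k3HilbertForm 2 (φ a) (φ a)) ^ 2) • P) ∧
    (IsOfHodgeType 4 X 2 2 0 (LinearEquiv.symm φ z) ∧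
      ∀ τ : complexBetti X 2, IsOfHodgeType 4 X 2 2 0 τ → ∃ t : ℂ, τ = t • LinearEquiv.symm φ z) ∧
    (∀ c : complexBetti X 2, IsOfHodgeType 4 X 2 1 1 c ↔
      (k3HilbertForm 2 (φ c) z = 0 ∧ k3HilbertForm 2 (φ c) (star z) = 0)) ∧
    (k3HilbertForm 2 z z = 0 ∧ 0 < (k3HilbertForm 2 (star z) z).re)))

/-- `qC` = the complex Beauville–Bogomolov form on `ℂ²³` as a Mathlib bilinear form. Local notation only. -/
local notation3 (prettyPrint := false) "qC" => Matrix.toBilin' (Matrix.map (k3HilbertGram 2) (Int.cast : ℤ → ℂ))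

/-- `Kap[φ, g] = Σ_{ij} (G⁻¹)_{ij} · φ⁻¹eᵢ ∪ g(φ⁻¹eⱼ) ∈ H⁴(X(ℂ); ℂ)`, the kappa class of an endomorphism `g`
of `H²(X(ℂ); ℂ)` (VERBATIM `…K3Sq2TypeHodgeGraphClassesGeneral`). Local notation only. -/
local notation3 (prettyPrint := false) "Kap[" φ ", " g "]" =>
  (∑ i : K3HilbertIndex, ∑ j : K3HilbertIndex,
    (((k3HilbertGram 2).map (Int.cast : ℤ → ℂ))⁻¹ i j) •
      cupProduct (rfl : 2 + 2 = 2 * 2) ((LinearEquiv.symm φ) (Pi.single i 1))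
        (g ((LinearEquiv.symm φ) (Pi.single j 1))))

variable {X : SchemeOver ℂ} {φ : complexBetti X 2 ≃ₗ[ℂ] (K3HilbertIndex → ℂ)} {P : complexBetti X (2 * 4)}
  {z : K3HilbertIndex → ℂ}

/-! ### Rationality -/

/-- `(G ⊗ ℂ)⁻¹ = G⁻¹ ⊗ ℂ` entrywise: the complex inverse Gram matrix has the rational entries `k3HilbertGramInv 2`.
[cite: OGrady2008NumericalK3Square, §3 ((mᵢⱼ) = (gᵢⱼ)⁻¹)] -/
theorem k3HilbertGram_map_inv_apply (i j : K3HilbertIndex) :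
    ((k3HilbertGram 2).map (Int.cast : ℤ → ℂ))⁻¹ i j = ((k3HilbertGramInv 2 i j : ℚ) : ℂ) := by
  rw [Matrix.inv_eq_left_inv k3HilbertGramInv_two_mul_complex, Matrix.map_apply]

/-- **`κ_g` is a rational class** when `g` preserves rational classes (marking clause (m2): the `αᵢ = φ⁻¹eᵢ`
are integral; `G⁻¹` is rational). [cite: OGrady2008NumericalK3Square, §3 proof of Claim 3.1]
[cite: VoisinHodgeI2002, §7.1.1] -/
theorem isRationalClass_kappaClass (hX : IsSmoothProjective 4 X) (hM : MarkedK3Sq[X, φ, P, z])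
    (g : complexBetti X 2 →ₗ[ℂ] complexBetti X 2) (hg : ∀ y, IsRationalClass y → IsRationalClass (g y)) :
    IsRationalClass Kap[φ, g] := by
  obtain ⟨-, hint, -⟩ := id hM
  have hα : ∀ k : K3HilbertIndex, IsRationalClass (φ.symm (Pi.single k 1) : complexBetti X 2) := by
    intro k
    refine (isRationalClass_iff_of_markedSq hX hint _).2 ⟨Pi.single k 1, ?_⟩
    rw [LinearEquiv.apply_symm_apply]
    funext i
    by_cases hi : i = k
    · subst hi; simp
    · simp [Pi.single_eq_of_ne hi]
  refine isRationalClass_sum _ fun i _ => isRationalClass_sum _ fun j _ => ?_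
  rw [k3HilbertGram_map_inv_apply]
  exact ((hα i).cup _ (hg _ (hα j))).smul _

/-! ### The kappa class as a contraction: independence of the resolution of `q⁻¹` -/

/-- **`κ_g = Σₖ v'ₖ ∪ g(vₖ)` for every resolution `Σₖ φ(v'ₖ)ᵢ φ(vₖ)ⱼ = (G⁻¹)ᵢⱼ` of the inverse tensor** (expand
`v'ₖ`, `vₖ` in the marking basis; bilinearity). [cite: OGrady2008NumericalK3Square, §2.1–2.2] -/
theorem kappaClass_eq_sum_of_resolution (φ : complexBetti X 2 ≃ₗ[ℂ] (K3HilbertIndex → ℂ))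
    (g : complexBetti X 2 →ₗ[ℂ] complexBetti X 2) {ι : Type*} [Fintype ι] (v v' : ι → complexBetti X 2)
    (hres : ∀ i j : K3HilbertIndex, ∑ k, φ (v' k) i * φ (v k) j = ((k3HilbertGram 2).map (Int.cast : ℤ → ℂ))⁻¹ i j) :
    Kap[φ, g] = ∑ k, cupProduct (rfl : 2 + 2 = 2 * 2) (v' k) (g (v k)) := by
  classical
  have hk : ∀ k, cupProduct (rfl : 2 + 2 = 2 * 2) (v' k) (g (v k)) =
      ∑ i : K3HilbertIndex, ∑ j : K3HilbertIndex, (φ (v' k) i * φ (v k) j) •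
        cupProduct (rfl : 2 + 2 = 2 * 2) (φ.symm (Pi.single i 1)) (g (φ.symm (Pi.single j 1))) := by
    intro k
    conv_lhs => rw [eq_sum_smul_symm_single φ (v' k), eq_sum_smul_symm_single φ (v k)]
    simp only [map_sum, map_smul, LinearMap.sum_apply, LinearMap.smul_apply, Finset.smul_sum, smul_smul]
    rw [Finset.sum_comm]
    exact Finset.sum_congr rfl fun i _ => Finset.sum_congr rfl fun j _ => by rw [mul_comm]
  simp_rw [hk]
  symm
  rw [Finset.sum_comm]
  refine Finset.sum_congr rfl fun i _ => ?_
  rw [Finset.sum_comm]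
  refine Finset.sum_congr rfl fun j _ => ?_
  rw [← Finset.sum_smul, hres i j]

/-- **A `q`-complete family resolves `q⁻¹`**: if `Σₖ q(φu, φvₖ) · v'ₖ = u` for every `u ∈ H²(X)`, then
`Σₖ φ(v'ₖ)ᵢ φ(vₖ)ⱼ = (G⁻¹)ᵢⱼ` (the matrix `M = Σₖ φv'ₖ ⊗ φvₖ` satisfies `M·G = 1`). [cite: OGrady2008NumericalK3Square, §2.1] -/
theorem resolution_of_complete (φ : complexBetti X 2 ≃ₗ[ℂ] (K3HilbertIndex → ℂ)) {ι : Type*} [Fintype ι]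
    (v v' : ι → complexBetti X 2)
    (hcomp : ∀ u : complexBetti X 2, ∑ k, k3HilbertForm 2 (φ u) (φ (v k)) • v' k = u) :
    ∀ i j : K3HilbertIndex, ∑ k, φ (v' k) i * φ (v k) j = ((k3HilbertGram 2).map (Int.cast : ℤ → ℂ))⁻¹ i j := by
  classical
  set M : Matrix K3HilbertIndex K3HilbertIndex ℂ := fun i j => ∑ k, φ (v' k) i * φ (v k) j with hM
  have hGsymm : ∀ j l : K3HilbertIndex, (k3HilbertGram 2).map (Int.cast : ℤ → ℂ) j l =
      (k3HilbertGram 2).map (Int.cast : ℤ → ℂ) l j := fun j l => by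
    rw [Matrix.map_apply, Matrix.map_apply, k3HilbertGram_apply_comm]
  -- `Σ_j φ(v k)_j G_{jl} = q(e_l, φ v_k)`
  have hrow : ∀ (k : ι) (l : K3HilbertIndex), ∑ j, φ (v k) j * (k3HilbertGram 2).map (Int.cast : ℤ → ℂ) j l =
      k3HilbertForm 2 (Pi.single l 1) (φ (v k)) := by
    intro k l
    rw [k3HilbertForm_single_left]
    simp only [Matrix.mulVec, dotProduct]
    exact Finset.sum_congr rfl fun j _ => by rw [hGsymm j l, mul_comm]
  -- completeness at `u = α_l`, coordinate `i`
  have hcol : ∀ i l : K3HilbertIndex, ∑ k, k3HilbertForm 2 (Pi.single l 1) (φ (v k)) * φ (v' k) i =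
      if i = l then 1 else 0 := by
    intro i l
    have h := congrArg (fun u => φ u i) (hcomp (φ.symm (Pi.single l 1)))
    simp only [map_sum, map_smul, LinearEquiv.apply_symm_apply, Finset.sum_apply, Pi.smul_apply,
      smul_eq_mul] at h
    rw [h, Pi.single_apply]
  have hMG : M * (k3HilbertGram 2).map (Int.cast : ℤ → ℂ) = 1 := by
    ext i l
    rw [Matrix.mul_apply, Matrix.one_apply]
    calc ∑ j, M i j * (k3HilbertGram 2).map (Int.cast : ℤ → ℂ) j l
        = ∑ j, ∑ k, φ (v' k) i * (φ (v k) j * (k3HilbertGram 2).map (Int.cast : ℤ → ℂ) j l) := by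
          refine Finset.sum_congr rfl fun j _ => ?_
          rw [hM, Finset.sum_mul]
          exact Finset.sum_congr rfl fun k _ => by ring
      _ = ∑ k, φ (v' k) i * ∑ j, φ (v k) j * (k3HilbertGram 2).map (Int.cast : ℤ → ℂ) j l := by
          rw [Finset.sum_comm]
          exact Finset.sum_congr rfl fun k _ => by rw [Finset.mul_sum]
      _ = ∑ k, k3HilbertForm 2 (Pi.single l 1) (φ (v k)) * φ (v' k) i :=
          Finset.sum_congr rfl fun k _ => by rw [hrow, mul_comm]
      _ = if i = l then 1 else 0 := hcol i l
  intro i j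
  rw [Matrix.inv_eq_left_inv hMG]

/-! ### A Hodge-adapted complete family -/

/-- **Decomposition `u = (q(φu, z̄)/N)·σ + (q(φu, z)/N)·σ̄ + h(u)` with `h(u) ∈ H^{1,1}`**, `N = q(z, z̄)`: for the
marking clauses (m5)–(m6), the class `u − (q(φu,z̄)/N)σ − (q(φu,z)/N)σ̄` is `q`-orthogonal to `z` and `z̄`.
[cite: Beauville1983, §8] [cite: VoisinHodgeI2002, §6.1.2] -/
theorem k3HilbertForm_hodgeRemainder (hM : MarkedK3Sq[X, φ, P, z]) (u : complexBetti X 2) :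
    k3HilbertForm 2 (φ (u - (k3HilbertForm 2 (φ u) (star z) / k3HilbertForm 2 z (star z)) • φ.symm z -
        (k3HilbertForm 2 (φ u) z / k3HilbertForm 2 z (star z)) • φ.symm (star z))) z = 0 ∧
      k3HilbertForm 2 (φ (u - (k3HilbertForm 2 (φ u) (star z) / k3HilbertForm 2 z (star z)) • φ.symm z -
        (k3HilbertForm 2 (φ u) z / k3HilbertForm 2 z (star z)) • φ.symm (star z))) (star z) = 0 := by
  obtain ⟨-, -, -, -, -, ⟨hzz, hzpos⟩⟩ := id hM
  have hN : k3HilbertForm 2 z (star z) ≠ 0 := by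
    intro h0
    rw [k3HilbertForm_comm] at h0
    rw [h0, Complex.zero_re] at hzpos
    exact lt_irrefl _ hzpos
  have hzbzb : k3HilbertForm 2 (star z) (star z) = 0 := by
    rw [← star_k3HilbertForm, hzz, star_zero]
  refine ⟨?_, ?_⟩
  · rw [map_sub, map_sub, map_smul, map_smul, LinearEquiv.apply_symm_apply, LinearEquiv.apply_symm_apply,
      sub_eq_add_neg, sub_eq_add_neg, k3HilbertForm_add_left, k3HilbertForm_add_left, ← neg_one_smul ℂ (_ • z),
      ← neg_one_smul ℂ (_ • star z), smul_smul, smul_smul, k3HilbertForm_smul_left, k3HilbertForm_smul_left, hzz,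
      k3HilbertForm_comm 2 (star z) z]
    field_simp
    ring
  · rw [map_sub, map_sub, map_smul, map_smul, LinearEquiv.apply_symm_apply, LinearEquiv.apply_symm_apply,
      sub_eq_add_neg, sub_eq_add_neg, k3HilbertForm_add_left, k3HilbertForm_add_left, ← neg_one_smul ℂ (_ • z),
      ← neg_one_smul ℂ (_ • star z), smul_smul, smul_smul, k3HilbertForm_smul_left, k3HilbertForm_smul_left, hzbzb]
    field_simp
    ring

/-- **A Hodge-adapted `q`-complete family.** For a marked `X` there are a finite type `ι` and families
`v, v' : ι → H²(X)` with `Σₖ q(φu, φvₖ) · v'ₖ = u` for all `u`, and for each `k` a pair of types `(p, q)`, `(p', q')`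
with `p + p' = 2`, `q + q' = 2`, `vₖ` of type `(p, q)` and `v'ₖ` of type `(p', q')`: the pairs `(σ, σ̄/N)`,
`(σ̄, σ/N)` and a basis of `H^{1,1}` with its `q`-dual basis (`q|_{H^{1,1}}` is non-degenerate because
`H² = ℂσ ⊕ ℂσ̄ ⊕ H^{1,1}` and `q` is non-degenerate). [cite: Beauville1983, §8–9] [cite: VoisinHodgeI2002, §6.1.2 and §7.1.1] -/
theorem exists_hodgeAdapted_complete (hX : IsSmoothProjective 4 X) (hM : MarkedK3Sq[X, φ, P, z]) :
    ∃ (n : ℕ) (v v' : Option (Option (Fin n)) → complexBetti X 2) (pq : Option (Option (Fin n)) → (ℕ × ℕ) × (ℕ × ℕ)),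
      (∀ u : complexBetti X 2, ∑ k, k3HilbertForm 2 (φ u) (φ (v k)) • v' k = u) ∧
      ∀ k, (pq k).1.1 + (pq k).2.1 = 2 ∧ (pq k).1.2 + (pq k).2.2 = 2 ∧
        IsOfHodgeType 4 X 2 (pq k).1.1 (pq k).1.2 (v k) ∧ IsOfHodgeType 4 X 2 (pq k).2.1 (pq k).2.2 (v' k) := by
  classical
  obtain ⟨-, hint, -, ⟨hz20, -⟩, h11, ⟨hzz, hzpos⟩⟩ := id hM
  haveI : FiniteDimensional ℂ (complexBetti X 2) := LinearEquiv.finiteDimensional φ.symm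
  have hN : k3HilbertForm 2 z (star z) ≠ 0 := by
    intro h0
    rw [k3HilbertForm_comm] at h0
    rw [h0, Complex.zero_re] at hzpos
    exact lt_irrefl _ hzpos
  set N : ℂ := k3HilbertForm 2 z (star z) with hNdef
  -- `σ̄` is of type `(0,2)`
  have hσbar : IsOfHodgeType 4 X 2 0 2 (φ.symm (star z)) := by
    have e1 : conjClass (ComplexPoints X) 2 (φ.symm z) = φ.symm (star z) := by
      apply φ.injective
      rw [marking_conjClass hint, LinearEquiv.apply_symm_apply, LinearEquiv.apply_symm_apply]
    have h := hz20.conjClass hX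
    rwa [e1] at h
  -- the form `q_X` and the subspace `H^{1,1}`
  set qX : LinearMap.BilinForm ℂ (complexBetti X 2) :=
    (qC).compl₁₂ (φ : complexBetti X 2 →ₗ[ℂ] (K3HilbertIndex → ℂ))
      (φ : complexBetti X 2 →ₗ[ℂ] (K3HilbertIndex → ℂ)) with hqXdef
  have hqX : ∀ x y, qX x y = k3HilbertForm 2 (φ x) (φ y) := fun x y => by
    rw [hqXdef, LinearMap.compl₁₂_apply, qC_apply]; rfl
  have hqXrefl : qX.IsRefl := fun x y h => by rw [hqX] at h ⊢; rwa [k3HilbertForm_comm]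
  set H11 : Submodule ℂ (complexBetti X 2) :=
    LinearMap.ker (qX.flip (φ.symm z)) ⊓ LinearMap.ker (qX.flip (φ.symm (star z))) with hH11def
  have hmem : ∀ y : complexBetti X 2, y ∈ H11 ↔
      k3HilbertForm 2 (φ y) z = 0 ∧ k3HilbertForm 2 (φ y) (star z) = 0 := by
    intro y
    rw [hH11def, Submodule.mem_inf, LinearMap.mem_ker, LinearMap.mem_ker, LinearMap.BilinForm.flip_apply,
      LinearMap.BilinForm.flip_apply, hqX, hqX, LinearEquiv.apply_symm_apply, LinearEquiv.apply_symm_apply]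
  -- the Hodge remainder `h(u) ∈ H^{1,1}`
  set rem : complexBetti X 2 → complexBetti X 2 := fun u =>
    u - (k3HilbertForm 2 (φ u) (star z) / N) • φ.symm z - (k3HilbertForm 2 (φ u) z / N) • φ.symm (star z)
    with hremdef
  have hrem : ∀ u, rem u ∈ H11 := fun u => (hmem _).2 (k3HilbertForm_hodgeRemainder hM u)
  have hdecomp : ∀ u : complexBetti X 2,
      u = (k3HilbertForm 2 (φ u) (star z) / N) • φ.symm z + (k3HilbertForm 2 (φ u) z / N) • φ.symm (star z) +
        rem u := fun u => by
    simp only [hremdef]; abel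
  -- `q` restricted to `H^{1,1}` is non-degenerate
  set qH : LinearMap.BilinForm ℂ H11 := qX.restrict H11 with hqHdef
  have hqH : ∀ x y : H11, qH x y = k3HilbertForm 2 (φ (x : complexBetti X 2)) (φ (y : complexBetti X 2)) :=
    fun x y => by rw [hqHdef, LinearMap.BilinForm.restrict_apply, LinearMap.domRestrict_apply, hqX]
  have hdisj : Disjoint H11 (qX.orthogonal H11) := by
    rw [Submodule.disjoint_def]
    intro y hy hyorth
    rw [LinearMap.BilinForm.mem_orthogonal_iff] at hyorth
    obtain ⟨hyz, hyzb⟩ := (hmem y).1 hy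
    have h0 : ∀ u : complexBetti X 2, k3HilbertForm 2 (φ u) (φ y) = 0 := by
      intro u
      rw [hdecomp u, map_add, map_add, map_smul, map_smul, LinearEquiv.apply_symm_apply,
        LinearEquiv.apply_symm_apply, k3HilbertForm_add_left, k3HilbertForm_add_left, k3HilbertForm_smul_left,
        k3HilbertForm_smul_left, k3HilbertForm_comm 2 z (φ y), k3HilbertForm_comm 2 (star z) (φ y), hyz, hyzb,
        mul_zero, mul_zero, zero_add, zero_add, ← hqX]
      exact hyorth _ (hrem u)
    have hφ : φ y = 0 := by
      refine qC_nondegenerate.1 _ fun w => ?_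
      have h := h0 (φ.symm w)
      rw [LinearEquiv.apply_symm_apply, k3HilbertForm_comm] at h
      rw [qC_apply, h]
    exact φ.injective (by rw [hφ, map_zero])
  have hqHnd : qH.Nondegenerate := qX.nondegenerate_restrict_of_disjoint_orthogonal hqXrefl hdisj
  -- a basis of `H^{1,1}` and its `q`-dual basis
  set n := Module.finrank ℂ H11 with hndef
  let b : Basis (Fin n) ℂ H11 := Module.finBasis ℂ H11
  let d : Basis (Fin n) ℂ H11 := qH.dualBasis hqHnd b
  have hdual : ∀ x : H11, ∑ k, qH x (b k) • d k = x := fun x => by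
    conv_rhs => rw [← d.sum_repr x]
    exact Finset.sum_congr rfl fun k _ => by rw [LinearMap.BilinForm.dualBasis_repr_apply]
  -- the family
  refine ⟨n,
    fun o => o.elim (φ.symm z) fun o' => o'.elim (φ.symm (star z)) fun k => (b k : complexBetti X 2),
    fun o => o.elim (N⁻¹ • φ.symm (star z)) fun o' => o'.elim (N⁻¹ • φ.symm z) fun k => (d k : complexBetti X 2),
    fun o => o.elim ((2, 0), (0, 2)) fun o' => o'.elim ((0, 2), (2, 0)) fun _ => ((1, 1), (1, 1)),
    fun u => ?_, fun o => ?_⟩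
  · -- completeness
    rw [Fintype.sum_option, Fintype.sum_option]
    simp only [Option.elim]
    rw [LinearEquiv.apply_symm_apply, LinearEquiv.apply_symm_apply, smul_smul, smul_smul]
    have hH : ∑ k : Fin n, k3HilbertForm 2 (φ u) (φ (b k : complexBetti X 2)) • (d k : complexBetti X 2) =
        rem u := by
      have h := congrArg (H11.subtype : H11 →ₗ[ℂ] complexBetti X 2) (hdual ⟨rem u, hrem u⟩)
      rw [map_sum] at h
      simp only [map_smul, Submodule.subtype_apply] at h
      rw [← h]
      refine Finset.sum_congr rfl fun k _ => ?_
      rw [hqH]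
      congr 1
      -- `q(φ u, φ b_k) = q(φ (rem u), φ b_k)` since `b_k ⟂ z, z̄`
      obtain ⟨hbz, hbzb⟩ := (hmem _).1 (b k).2
      show k3HilbertForm 2 (φ u) (φ (b k : complexBetti X 2)) =
        k3HilbertForm 2 (φ (rem u)) (φ (b k : complexBetti X 2))
      simp only [hremdef, map_sub, map_smul, LinearEquiv.apply_symm_apply]
      rw [sub_eq_add_neg, sub_eq_add_neg, k3HilbertForm_add_left, k3HilbertForm_add_left, ← neg_one_smul ℂ (_ • z),
        ← neg_one_smul ℂ (_ • star z), smul_smul, smul_smul, k3HilbertForm_smul_left, k3HilbertForm_smul_left,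
        k3HilbertForm_comm 2 z, k3HilbertForm_comm 2 (star z), hbz, hbzb]
      ring
    rw [hH]
    conv_rhs => rw [hdecomp u]
    simp only [div_eq_mul_inv]
    abel
  · -- types
    rcases o with _ | _ | k
    · simp only [Option.elim]
      exact ⟨by trivial, by trivial, hz20, hσbar.smul _⟩
    · simp only [Option.elim]
      exact ⟨by trivial, by trivial, hσbar, hz20.smul _⟩
    · simp only [Option.elim]
      exact ⟨by trivial, by trivial, (h11 _).2 ((hmem _).1 (b k).2), (h11 _).2 ((hmem _).1 (d k).2)⟩

/-! ### The kappa class of a Hodge endomorphism is of type `(2,2)` -/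

/-- **`κ_g` is of Hodge type `(2,2)` for every type-preserving endomorphism `g` of `H²(X(ℂ); ℂ)`** (marked
smooth projective fourfold): write `κ_g = Σₖ v'ₖ ∪ g(vₖ)` in a Hodge-adapted complete family
(`exists_hodgeAdapted_complete`, `resolution_of_complete`, `kappaClass_eq_sum_of_resolution`); each term has type
`(p' + p, q' + q) = (2,2)` since cup products add types (`CupPreservesHodgeType`, a tree theorem) and `g` preserves
the type of `vₖ`. [cite: VoisinHodgeI2002, §6.1.2, §7.1.1 and §11.1] [cite: OGrady2008NumericalK3Square, §2.2] -/
theorem isOfHodgeType_kappaClass (hX : IsSmoothProjective 4 X) (hM : MarkedK3Sq[X, φ, P, z])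
    (g : complexBetti X 2 →ₗ[ℂ] complexBetti X 2)
    (hg : ∀ (i j : ℕ) y, IsOfHodgeType 4 X 2 i j y → IsOfHodgeType 4 X 2 i j (g y)) :
    IsOfHodgeType 4 X (2 * 2) 2 2 Kap[φ, g] := by
  classical
  obtain ⟨n, v, v', pq, hcomp, htyp⟩ := exists_hodgeAdapted_complete hX hM
  rw [kappaClass_eq_sum_of_resolution φ g v v' (resolution_of_complete φ v v' hcomp)]
  obtain ⟨A⟩ := nonempty_hodgeModel_holds hX
  have hcup : CupPreservesHodgeType 4 X :=
    BettiUniverse.cupPreservesHodgeType exists_isReal_hodgeModel_holds hodgePQ_independent_of_hodgeModel_holds hX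
  refine IsOfHodgeType.sum hX A _ _ fun k _ => ?_
  obtain ⟨hp, hq, hv, hv'⟩ := htyp k
  have h := hcup (rfl : 2 + 2 = 2 * 2) hv' (hg _ _ _ hv)
  rw [show (pq k).2.1 + (pq k).1.1 = 2 by omega, show (pq k).2.2 + (pq k).1.2 = 2 by omega] at h
  exact h

end Summit.HodgeConjecture.HodgeConjecture.Theorems.MarkmanPartnerTransport.PartnerLattice

end
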